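import Summits.QuantumFields.YangMills.Theorems.BalabanUVNodesN15TwoSpacingGluingCurvedKnitSmallFieldDefect
import Summits.QuantumFields.YangMills.Theorems.BalabanUVNodesN15TwoSpacingGluingCurvedKnitSmallFieldNodeObjects
import HarnessLib

/-!
# THE GLUING STEP AT TWO LATTICE SPACINGS — (Λ2c) `NE2PlusOperator` BY NAME FOR THE LIVE-BACKGROUND GLUED FAMILY IN THE GLOBAL SMALL-FIELD GAUGE: ENTRY 0 CONSTRUCTED AND PROVED
# (FILE 130's η-rate, the window closed through the LIVE guard `M₅ ≤ M = L^m`), ENTRIES 1–3 DISPLAYED (dag-n15-c g16, FILE 132; N15 = NE2, s1 «background-layer OPERATOR ingredient»)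

Cell `pub-ymgap`, seat `pub-ymgap-dag-n15-c` (R134 (a); HUMAN RULING D-0062), generation 16.  `bears_on: R4∕N15 · K3⁸ SpineGivenEndpointR13SepCoPHV (stmt-QuantumFields-27366)`.
Filed `--kind proof --supports stmt-QuantumFields-27366 --as helper` — COUNT-NEUTRAL.  Theorems only; 0 `def`, 0 `sorry`.  Imports BY NAME FILE 130 `…CurvedKnitSmallFieldDefect` (`sf_idef_cvGlued`),
FILE 131 `…CurvedKnitSmallFieldNodeObjects` (`SfIdx`, `sfGeo`, `sfGaugeBg`, `sfInstance`, `sfEntry0`, `sfOps`, `sfFamily`), n15-b `OperatorReadout` (`etaRateIneq342_of_hasMaj`,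
`rateFactor_opGeo`, `pref4_pos`), dag-n15-a `rateWeight_unitTorusGeoS`.  Nothing in the tree is modified.

WHAT.
* §1 `sfGeo_len` (every site of the sized unit-torus carrier has scale length `L^kη = 1`), `sfGeo_rateFactor` (the rate factor of the realised geometry is `(L^k)^{−γ}`), `sfGeo_dist_nonneg`,
  `sfScale_eq` (FILE 130's scale is linear in the window radius).
* §2 ★★★ `ne2PlusOperator_sf` — `T4EtaRate.NE2PlusOperator c₃₅ (sfInstance d mm ι hL) (fun i => sfFamily d mm ι a e hL i (E i))`: for odd `L ≥ 7`, `a > 0`, `c₃₅ > 0`, trace-form coordinates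
  `e` of `𝔲(m)`, and ANY choice of the entries 1–3 operators `E i n` obeying the (3.42)-shaped block majorant under the class with uniform constants (DISPLAYED — the gradient entries of
  the live glued operator are not in the tree): there are UNIFORM `M₅, δ₀, a₀, B₀, γ > 0` such that for `M₅ ≤ M = L^m`, `0 < α₀`, `Mα₀ ≤ a₀` and every skew-Hermitian fine potential `A′`
  in the C² window at scale `c₃₅Mα₀` the four entries obey `EtaRateIneq342` — ENTRY 0 from FILE 130 `sf_idef_cvGlued` (rate `γ = min(1∕16, γ₁)`, `δ₀ = min(δ∕16, δ₁)`; the window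
  `c₃₅L^mα₀ ≤ c₃₅a₀` closes FILE 130's two smallness rows; `w₀ ≤ L^m` through the LIVE guard), entries 1–3 from the displayed rows.

HONEST FRAMING ∕ LIMITS.  By-name readout (n15-b A2's pattern «entry 0 constructed, entries 1–3 displayed») of a MODEL family: global small-field gauge, covariant Laplacian (3.50) ⊗ colour
+ FLAT nonlocal part (1.69) (NOT Bałaban's `Δ_a(U)` (3.26)), C² window incl. all mixed second differences ((3.36) prints `∂*∂A` only), coarse background := King block mean (not
[Balaban1985Averaging]'s average), MODEL carriers, crude constants; entries 1–3 NOT produced here.  The η-rate inequality is NOT PRINTED ([B9] Thm 3.14 = domain differences); nothing of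
[B5]∕[B6]∕[B9] asserted.  NE2⁺ NOT PRINTED, NOT proved; N15 NOT discharged; K3⁸ OPEN, skeleton v6 untouched (0∕2); counts of record UNMOVED (typed 28∕28 · discharged 5∕27 · A 5∕28); one finite
𝕋⁴ at fixed ε — NOT infinite volume, NOT OS on ℝ⁴, NOT a mass gap, NOT Clay; R4 closes the conditional finite-𝕋⁴ rung `BalabanLadder.UV` only.  Restate-immune (no Theses import).
-/

noncomputable section

open scoped BigOperators Matrix Matrix.Norms.Frobenius

namespace Summit.QuantumFields.YangMills.BalabanUVNodes.N15.Gluing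

open Literature.MathematicalPhysics.QuantumFieldTheory.Balaban1983to89
open Literature.MathematicalPhysics.QuantumFieldTheory.Balaban1983to89.B11SectG (BlockNorm HasMaj)
open Literature.MathematicalPhysics.QuantumFieldTheory.Balaban1983to89.T4EtaRate (NE2PlusOperator EtaRateIneq342 rateFactor rateFactor_nonneg)
open Literature.MathematicalPhysics.QuantumFieldTheory.Balaban1983to89.T4EtaRateDefect (rateWeight)
open Literature.Barriers.QuantumFields (traceForm)
open Summit.QuantumFields.YangMills.BalabanUVNodes.N15.VectorPiece (bshiftEquiv kingPrV unitTorusGeoS rateWeight_unitTorusGeoS)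
open Summit.QuantumFields.YangMills.BalabanUVNodes.N15.MatrixSpecies (liftBlk basisConst basisConst_nonneg)
open Summit.QuantumFields.YangMills.BalabanUVNodes.N15.OperatorReadout (opGeo opFamily opGeo_len rateFactor_opGeo etaRateIneq342_of_hasMaj pref4_pos)
open Literature.MathematicalPhysics.QuantumFieldTheory.King1986.Torus (tdistT_nonneg)

variable {d : ℕ} {L : ℕ} [NeZero L]

/-! ## §1 The realised geometry of the index: scale length, rate factor, distance -/

section Geo

variable (d)

/-- Every site of the sized unit-torus carrier has scale length `L^kη = 1`. [folklore] -/
theorem sfGeo_len (hL : Odd L ∧ 1 < L) (i : SfIdx d L) (y : (sfGeo d hL i).Site) : (sfGeo d hL i).len y = 1 := by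
  show (L : ℝ) ^ i.kk * ((L : ℝ) ^ i.kk)⁻¹ = 1
  exact mul_inv_cancel₀ (pow_ne_zero _ (Nat.cast_ne_zero.mpr (NeZero.ne L)))

/-- The rate factor of the realised operator geometry is `(L^k)^{−γ}`. [cite: King1986, Prop. 3.9 (3.73) p.665 (rate factor, shape)] -/
theorem sfGeo_rateFactor (hL : Odd L ∧ 1 < L) (i : SfIdx d L) {X : Type} [Fintype X] (blk : X → (sfGeo d hL i).Site) (γ : ℝ) (y : (sfGeo d hL i).Site) :
    rateFactor (opGeo (sfGeo d hL i) X blk) γ y = ((L : ℝ) ^ i.kk) ^ (-γ) := by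
  have hLpos : (0 : ℝ) < (L : ℝ) := Nat.cast_pos.mpr (Nat.pos_of_ne_zero (NeZero.ne L))
  have hη : (sfGeo d hL i).eta ≠ 0 := by
    show ((L : ℝ) ^ i.kk)⁻¹ ≠ 0
    exact inv_ne_zero (pow_ne_zero _ hLpos.ne')
  rw [rateFactor_opGeo (sfGeo d hL i) X blk hη hLpos γ y]
  exact rateWeight_unitTorusGeoS L (cvM d L i.m i.kk hL) i.kk ((L : ℝ) ^ i.m) γ y

omit [NeZero L] in
/-- `d ≥ 0` on the carrier. [folklore] -/
theorem sfGeo_dist_nonneg (hL : Odd L ∧ 1 < L) (i : SfIdx d L) (y y' : (sfGeo d hL i).Site) : 0 ≤ (sfGeo d hL i).dist y y' := tdistT_nonneg _ y y'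

omit [NeZero L] in
/-- A block majorant on the unit-torus carrier IS one on the SIZED carrier (the size parameter `M` does not enter the block norms). [folklore] -/
theorem hasMaj_unitTorusGeoS {M : Fin (d + 1) → ℕ} [∀ μ, NeZero (M μ)] {k : ℕ} (Msz : ℝ) {X₁ X₂ : Type} [Fintype X₁] [Fintype X₂]
    {blk₁ : X₁ → (Literature.MathematicalPhysics.QuantumFieldTheory.Balaban1983to89.B6UnitTorusCarrier.unitTorusGeo L k M).Site}
    {blk₂ : X₂ → (Literature.MathematicalPhysics.QuantumFieldTheory.Balaban1983to89.B6UnitTorusCarrier.unitTorusGeo L k M).Site} {T : (X₁ → ℝ) →ₗ[ℝ] (X₂ → ℝ)}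
    {K : (Literature.MathematicalPhysics.QuantumFieldTheory.Balaban1983to89.B6UnitTorusCarrier.unitTorusGeo L k M).Site →
      (Literature.MathematicalPhysics.QuantumFieldTheory.Balaban1983to89.B6UnitTorusCarrier.unitTorusGeo L k M).Site → ℝ}
    (h : HasMaj (BlockNorm.ofBlocks (Literature.MathematicalPhysics.QuantumFieldTheory.Balaban1983to89.B6UnitTorusCarrier.unitTorusGeo L k M) blk₁)
      (BlockNorm.ofBlocks (Literature.MathematicalPhysics.QuantumFieldTheory.Balaban1983to89.B6UnitTorusCarrier.unitTorusGeo L k M) blk₂) T K) :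
    HasMaj (BlockNorm.ofBlocks (unitTorusGeoS L k M Msz) blk₁) (BlockNorm.ofBlocks (unitTorusGeoS L k M Msz) blk₂) T K :=
  fun y' μ hμ y => h y' μ hμ y

end Geo

/-! ## §2 `NE2PlusOperator` by name: entry 0 constructed, entries 1–3 displayed -/

section Node

variable (d) (mm ι : Type) [Fintype mm] [DecidableEq mm] [Fintype ι] [DecidableEq ι] (e : Matrix mm mm ℂ ≃L[ℝ] (ι → ℝ))

set_option maxHeartbeats 800000 in
/-- ★★★ **NE2⁺, OPERATOR LAYER, BY NAME, FOR THE LIVE-BACKGROUND GLUED FAMILY AT THE COVER — ENTRY 0 CONSTRUCTED AND PROVED, ENTRIES 1–3 DISPLAYED, `M = L^m` LIVE.**  For odd `L ≥ 7`,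
`a > 0`, `c₃₅ > 0`, trace-form-orthonormal coordinates `e` of `𝔲(m)`: if the consumer's entries 1–3 operators `E i n` (`n ≠ 0`) obey, for `M₁ ≤ L^m`, `0 < α₀`, `L^mα₀ ≤ a₁` and every
`A′` in the class, the (3.42)-shaped block majorant `B₁·pref4(len)_n·e^{−δ₁d}·max(rf_{γ₁}(y), rf_{γ₁}(y′))` (uniform `M₁, δ₁, a₁, B₁, γ₁ > 0`), then
`NE2PlusOperator c₃₅ (sfInstance d mm ι hL) (fun i => sfFamily d mm ι a e hL i (E i))` — whose ENTRY 0 is the η-defect of the live glued propagators, bounded by FILE 130 with NO displayed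
row.  MODEL family; NOT [B9] Thm 3.1∕3.14 as printed.
[cite: Balaban1985BackgroundPropagators, Thm 3.1 p.397 (quantifier template «M ≥ M₁ … Mα₀ ≤ a₀», (3.42)), Thm 3.14 pp.426–427 (difference template), (3.35)–(3.36) p.396; King1986, Prop. 3.9 (3.73) p.665 (rate factor); Balaban1984PropagatorsII, (2.91)–(2.93) p.239] -/
theorem ne2PlusOperator_sf (hL : Odd L ∧ 1 < L) (hL7 : 7 ≤ L) {a : ℝ} (ha : 0 < a) {c35 : ℝ} (hc35 : 0 < c35) (he : ∀ A B : Matrix mm mm ℂ, traceForm A B = e A ⬝ᵥ e B)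
    (E : ∀ i : SfIdx d L, Fin 4 → (Fin (d + 1) → CvX' d L i.m i.kk i.r hL → Matrix mm mm ℂ) → ((CvX d L i.m i.kk hL × ι → ℝ) →ₗ[ℝ] (CvX' d L i.m i.kk i.r hL × ι → ℝ)))
    (hE : ∃ M₁ δ₁ a₁ B₁ γ₁ : ℝ, 0 < M₁ ∧ 0 < δ₁ ∧ 0 < a₁ ∧ 0 < B₁ ∧ 0 < γ₁ ∧
      ∀ i : SfIdx d L, M₁ ≤ (L : ℝ) ^ i.m → ∀ α₀ : ℝ, 0 < α₀ → (L : ℝ) ^ i.m * α₀ ≤ a₁ →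
        ∀ A' : Fin (d + 1) → CvX' d L i.m i.kk i.r hL → Matrix mm mm ℂ, (sfInstance d mm ι hL i).Bf.Reg335 c35 α₀ A' → ∀ n : Fin 4, n ≠ 0 →
          HasMaj (BlockNorm.ofBlocks (sfGeo d hL i) (liftBlk (cvBlk d L i.m i.kk hL) ι))
            (BlockNorm.ofBlocks (sfGeo d hL i) (liftBlk (cvBlk d L i.m i.kk hL ∘ kingPrV L i.kk i.r (cvM d L i.m i.kk hL)) ι)) (E i n A')
            (fun y y' => B₁ * B9.pref4 ((opGeo (sfGeo d hL i) (CvX d L i.m i.kk hL × ι) (liftBlk (cvBlk d L i.m i.kk hL) ι)).len y) n * Real.exp (-(δ₁ * (sfGeo d hL i).dist y y')) *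
              max (rateFactor (opGeo (sfGeo d hL i) (CvX d L i.m i.kk hL × ι) (liftBlk (cvBlk d L i.m i.kk hL) ι)) γ₁ y)
                (rateFactor (opGeo (sfGeo d hL i) (CvX d L i.m i.kk hL × ι) (liftBlk (cvBlk d L i.m i.kk hL) ι)) γ₁ y'))) :
    NE2PlusOperator c35 (sfInstance d mm ι hL) (fun i => sfFamily d mm ι a e hL i (E i)) := by
  obtain ⟨δ, w₀, R₀, D, hδ, hR₀, H⟩ := sf_idef_cvGlued (d := d) hL hL7 ha ι
  obtain ⟨M₁, δ₁, a₁, B₁, γ₁, hM₁, hδ₁, ha₁, hB₁, hγ₁, hE⟩ := hE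
  have hLpos : 0 < L := Nat.pos_of_ne_zero (NeZero.ne L)
  have hLr : (0 : ℝ) < (L : ℝ) := Nat.cast_pos.mpr hLpos
  have hL1 : (1 : ℝ) ≤ (L : ℝ) := by exact_mod_cast hLpos
  -- the constants
  have hκ0 : 0 ≤ basisConst e := basisConst_nonneg e
  let σ : ℝ := 14 * Real.exp 1 * (1 + Fintype.card (Fin (d + 1))) * basisConst e * ((1 + Fintype.card (Fin (d + 1))) * (3 + 2 * ((d : ℝ) + 1)))
  have hσ0 : 0 ≤ σ := by positivity
  let JJ : ℝ := 1 + Fintype.card (Fin (d + 1) ⊕ Fin (d + 1))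
  have hJJ0 : 0 ≤ JJ := by positivity
  let W : ℝ := 2 * ((1 + Fintype.card (Fin (d + 1))) * (3 + 2 * ((d : ℝ) + 1)))
  have hW0 : 0 < W := by positivity
  let aW : ℝ := 1 / (W * c35)
  have haW : 0 < aW := by positivity
  let aR : ℝ := R₀ / (σ * c35 * JJ + 1)
  have haR : 0 < aR := by positivity
  let a₀ : ℝ := min a₁ (min aW aR)
  have ha₀ : 0 < a₀ := lt_min ha₁ (lt_min haW haR)
  have ha₀a₁ : a₀ ≤ a₁ := min_le_left _ _
  have ha₀W : a₀ ≤ aW := (min_le_right _ _).trans (min_le_left _ _)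
  have ha₀R : a₀ ≤ aR := (min_le_right _ _).trans (min_le_right _ _)
  let M₅ : ℝ := max (max w₀ M₁) 1
  have hM₅ : 0 < M₅ := lt_of_lt_of_le one_pos (le_max_right _ _)
  let δ₀ : ℝ := min (δ / 16) δ₁
  have hδ₀ : 0 < δ₀ := lt_min (by positivity) hδ₁
  let γ : ℝ := min (1 / 16 : ℝ) γ₁
  have hγ : 0 < γ := lt_min (by norm_num) hγ₁
  let B₀ : ℝ := max D 0 * (1 + σ * (c35 * a₀) * JJ) + B₁
  have hB₀ : 0 < B₀ := add_pos_of_nonneg_of_pos (by positivity) hB₁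
  refine ⟨M₅, δ₀, a₀, B₀, γ, hM₅, hδ₀, ha₀, hB₀, hγ, fun i hM α₀ hα₀ hMa A' hA' => ?_⟩
  -- the guard `M₅ ≤ gf.M = L^m`
  have hM' : M₅ ≤ (L : ℝ) ^ i.m := hM
  have hw₀ : w₀ ≤ ((L ^ i.m : ℕ) : ℝ) := by push_cast; exact ((le_max_left _ _).trans (le_max_left _ _)).trans hM'
  have hM₁' : M₁ ≤ (L : ℝ) ^ i.m := ((le_max_right _ _).trans (le_max_left _ _)).trans hM'
  have hMa₁ : (L : ℝ) ^ i.m * α₀ ≤ a₁ := hMa.trans ha₀a₁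
  have hη0 : (0 : ℝ) ≤ (sfGeo d hL i).eta := by
    show (0 : ℝ) ≤ ((L : ℝ) ^ i.kk)⁻¹
    positivity
  -- the scalar facts at the index
  have hx1 : (1 : ℝ) ≤ (L : ℝ) ^ i.kk := one_le_pow₀ hL1
  have hxpos : (0 : ℝ) < (L : ℝ) ^ i.kk := pow_pos hLr _
  have hcast : (((L ^ i.kk : ℕ) : ℝ)) = (L : ℝ) ^ i.kk := by push_cast; rfl
  have hrf : ∀ y : (sfGeo d hL i).Site, ∀ γ' : ℝ, rateFactor (opGeo (sfGeo d hL i) (CvX d L i.m i.kk hL × ι) (liftBlk (cvBlk d L i.m i.kk hL) ι)) γ' y = ((L : ℝ) ^ i.kk) ^ (-γ') :=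
    fun y γ' => sfGeo_rateFactor d hL i _ γ' y
  have hγle : γ ≤ 1 / 16 := min_le_left _ _
  have hγle₁ : γ ≤ γ₁ := min_le_right _ _
  have hrfγ : ((L : ℝ) ^ i.kk) ^ (-(1 / 16 : ℝ)) ≤ ((L : ℝ) ^ i.kk) ^ (-γ) := Real.rpow_le_rpow_of_exponent_le hx1 (by linarith)
  have hrfγ₁ : ((L : ℝ) ^ i.kk) ^ (-γ₁) ≤ ((L : ℝ) ^ i.kk) ^ (-γ) := Real.rpow_le_rpow_of_exponent_le hx1 (by linarith)
  have hinv : ((L : ℝ) ^ i.kk)⁻¹ ≤ ((L : ℝ) ^ i.kk) ^ (-(1 / 16 : ℝ)) := by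
    rw [← Real.rpow_neg_one]
    exact Real.rpow_le_rpow_of_exponent_le hx1 (by norm_num)
  have hδ₀le : δ₀ ≤ δ / 16 := min_le_left _ _
  have hδ₀le₁ : δ₀ ≤ δ₁ := min_le_right _ _
  refine etaRateIneq342_of_hasMaj (liftBlk (cvBlk d L i.m i.kk hL) ι) (liftBlk (cvBlk d L i.m i.kk hL ∘ kingPrV L i.kk i.r (cvM d L i.m i.kk hL)) ι) hη0 hLr.le hB₀.le
    (sfOps d mm ι a e hL i (E i)) A' fun n => ?_
  by_cases hn : n = 0
  · -- ENTRY 0: FILE 130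
    subst hn
    rw [sfOps_zero]
    obtain ⟨hskew, h1, h2, h3⟩ := (sfInstance_reg335_iff d mm ι hL i c35 α₀ A').1 hA'
    have hconv : ((L : ℝ) ^ i.kk)⁻¹ * ((L : ℝ) ^ i.r)⁻¹ = (((L ^ i.r * L ^ i.kk : ℕ) : ℝ))⁻¹ := by
      push_cast
      rw [mul_inv, mul_comm]
    have hrA0 : 0 ≤ c35 * (L : ℝ) ^ i.m * α₀ := by positivity
    have hrAa : c35 * (L : ℝ) ^ i.m * α₀ ≤ c35 * a₀ := by
      rw [mul_assoc]; exact mul_le_mul_of_nonneg_left hMa hc35.le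
    have h2' : ∀ μ κ x', ‖A' μ (bshiftEquiv (cvM d L i.m i.kk hL) (L ^ i.r * L ^ i.kk) κ x') - A' μ x'‖ ≤ c35 * (L : ℝ) ^ i.m * α₀ * ((((L ^ i.r * L ^ i.kk : ℕ) : ℝ))⁻¹) :=
      fun μ κ x' => (h2 μ κ x').trans_eq (by rw [hconv])
    have h3' : ∀ μ κ x', ‖(A' μ (bshiftEquiv (cvM d L i.m i.kk hL) (L ^ i.r * L ^ i.kk) κ x') - A' μ x') -
        (A' μ (bshiftEquiv (cvM d L i.m i.kk hL) (L ^ i.r * L ^ i.kk) κ ((bshiftEquiv (cvM d L i.m i.kk hL) (L ^ i.r * L ^ i.kk) μ).symm x')) -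
          A' μ ((bshiftEquiv (cvM d L i.m i.kk hL) (L ^ i.r * L ^ i.kk) μ).symm x'))‖ ≤
        c35 * (L : ℝ) ^ i.m * α₀ * ((((L ^ i.r * L ^ i.kk : ℕ) : ℝ))⁻¹) * ((((L ^ i.r * L ^ i.kk : ℕ) : ℝ))⁻¹) :=
      fun μ κ x' => (h3 μ κ x').trans_eq (by rw [hconv])
    have hr2 : 2 * ((1 + Fintype.card (Fin (d + 1))) * ((3 + 2 * ((d : ℝ) + 1)) * (c35 * (L : ℝ) ^ i.m * α₀))) ≤ 1 := by
      have hWa : W * (c35 * a₀) ≤ 1 := by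
        calc W * (c35 * a₀) ≤ W * (c35 * aW) := mul_le_mul_of_nonneg_left (mul_le_mul_of_nonneg_left ha₀W hc35.le) hW0.le
          _ = 1 := by
            show W * (c35 * (1 / (W * c35))) = 1
            field_simp
      calc 2 * ((1 + Fintype.card (Fin (d + 1))) * ((3 + 2 * ((d : ℝ) + 1)) * (c35 * (L : ℝ) ^ i.m * α₀))) = W * (c35 * (L : ℝ) ^ i.m * α₀) := by ring
        _ ≤ W * (c35 * a₀) := mul_le_mul_of_nonneg_left hrAa hW0.le
        _ ≤ 1 := hWa
    have hscale : 14 * Real.exp 1 * (1 + Fintype.card (Fin (d + 1))) * basisConst e * ((1 + Fintype.card (Fin (d + 1))) * ((3 + 2 * ((d : ℝ) + 1)) * (c35 * (L : ℝ) ^ i.m * α₀))) =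
        σ * (c35 * (L : ℝ) ^ i.m * α₀) := by ring
    have hSle : σ * (c35 * (L : ℝ) ^ i.m * α₀) ≤ σ * (c35 * a₀) := mul_le_mul_of_nonneg_left hrAa hσ0
    have hRle : 14 * Real.exp 1 * (1 + Fintype.card (Fin (d + 1))) * basisConst e * ((1 + Fintype.card (Fin (d + 1))) * ((3 + 2 * ((d : ℝ) + 1)) * (c35 * (L : ℝ) ^ i.m * α₀))) *
        (1 + Fintype.card (Fin (d + 1) ⊕ Fin (d + 1))) ≤ R₀ := by
      rw [hscale]
      have hRa : σ * (c35 * aR) * JJ ≤ R₀ := by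
        have hden : 0 < σ * c35 * JJ + 1 := by positivity
        calc σ * (c35 * aR) * JJ = R₀ * (σ * c35 * JJ) / (σ * c35 * JJ + 1) := by
              show σ * (c35 * (R₀ / (σ * c35 * JJ + 1))) * JJ = R₀ * (σ * c35 * JJ) / (σ * c35 * JJ + 1)
              field_simp
          _ ≤ R₀ * (σ * c35 * JJ + 1) / (σ * c35 * JJ + 1) := by gcongr; linarith
          _ = R₀ := by field_simp
      calc σ * (c35 * (L : ℝ) ^ i.m * α₀) * JJ ≤ σ * (c35 * a₀) * JJ := mul_le_mul_of_nonneg_right hSle hJJ0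
        _ ≤ σ * (c35 * aR) * JJ := mul_le_mul_of_nonneg_right (mul_le_mul_of_nonneg_left (mul_le_mul_of_nonneg_left ha₀R hc35.le) hσ0) hJJ0
        _ ≤ R₀ := hRa
    have key := hasMaj_unitTorusGeoS (d := d) (L := L) ((L : ℝ) ^ i.m) (H i.m i.kk i.r i.one_le hw₀ e he A' hskew (c35 * (L : ℝ) ^ i.m * α₀) hrA0 h1 h2' h3' hr2 hRle)
    unfold sfEntry0
    refine key.mono fun y y' => ?_
    -- the scalar comparison of the two kernels
    rw [opGeo_len, sfGeo_len d hL i y, hrf y γ, hrf y' γ, max_self, hcast]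
    have hpref : B9.pref4 (1 : ℝ) 0 = 1 := by simp [B9.pref4]
    rw [hpref, mul_one]
    have hd0 : 0 ≤ (sfGeo d hL i).dist y y' := sfGeo_dist_nonneg d hL i y y'
    have hexp : Real.exp (-(δ / 16 * (Literature.MathematicalPhysics.QuantumFieldTheory.Balaban1983to89.B6UnitTorusCarrier.unitTorusGeo L i.kk (cvM d L i.m i.kk hL)).dist y y')) ≤
        Real.exp (-(δ₀ * (sfGeo d hL i).dist y y')) := by
      refine Real.exp_le_exp.mpr (neg_le_neg ?_)
      exact mul_le_mul_of_nonneg_right hδ₀le hd0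
    have hE0 : 0 ≤ Real.exp (-(δ / 16 * (Literature.MathematicalPhysics.QuantumFieldTheory.Balaban1983to89.B6UnitTorusCarrier.unitTorusGeo L i.kk (cvM d L i.m i.kk hL)).dist y y')) :=
      Real.exp_nonneg _
    have hS0 : 0 ≤ σ * (c35 * (L : ℝ) ^ i.m * α₀) := mul_nonneg hσ0 hrA0
    have hbr : ((L : ℝ) ^ i.kk) ^ (-(1 / 16 : ℝ)) + σ * (c35 * (L : ℝ) ^ i.m * α₀) * (1 + Fintype.card (Fin (d + 1) ⊕ Fin (d + 1))) * ((L : ℝ) ^ i.kk)⁻¹ ≤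
        (1 + σ * (c35 * a₀) * JJ) * ((L : ℝ) ^ i.kk) ^ (-γ) := by
      have hA : ((L : ℝ) ^ i.kk) ^ (-(1 / 16 : ℝ)) ≤ ((L : ℝ) ^ i.kk) ^ (-γ) := hrfγ
      have hB : σ * (c35 * (L : ℝ) ^ i.m * α₀) * (1 + Fintype.card (Fin (d + 1) ⊕ Fin (d + 1))) * ((L : ℝ) ^ i.kk)⁻¹ ≤ σ * (c35 * a₀) * JJ * ((L : ℝ) ^ i.kk) ^ (-γ) :=
        mul_le_mul (mul_le_mul_of_nonneg_right hSle hJJ0) (hinv.trans hrfγ) (by positivity) (by positivity)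
      nlinarith [hA, hB]
    have hrpos : 0 ≤ ((L : ℝ) ^ i.kk) ^ (-γ) := Real.rpow_nonneg hxpos.le _
    calc D * (((L : ℝ) ^ i.kk) ^ (-(1 / 16 : ℝ)) + 14 * Real.exp 1 * (1 + Fintype.card (Fin (d + 1))) * basisConst e * ((1 + Fintype.card (Fin (d + 1))) *
            ((3 + 2 * ((d : ℝ) + 1)) * (c35 * (L : ℝ) ^ i.m * α₀))) * (1 + Fintype.card (Fin (d + 1) ⊕ Fin (d + 1))) * ((L : ℝ) ^ i.kk)⁻¹) *
          Real.exp (-(δ / 16 * (Literature.MathematicalPhysics.QuantumFieldTheory.Balaban1983to89.B6UnitTorusCarrier.unitTorusGeo L i.kk (cvM d L i.m i.kk hL)).dist y y'))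
        ≤ max D 0 * ((1 + σ * (c35 * a₀) * JJ) * ((L : ℝ) ^ i.kk) ^ (-γ)) *
          Real.exp (-(δ / 16 * (Literature.MathematicalPhysics.QuantumFieldTheory.Balaban1983to89.B6UnitTorusCarrier.unitTorusGeo L i.kk (cvM d L i.m i.kk hL)).dist y y')) := by
          rw [hscale]
          refine mul_le_mul_of_nonneg_right ?_ hE0
          have hsum0 : 0 ≤ ((L : ℝ) ^ i.kk) ^ (-(1 / 16 : ℝ)) + σ * (c35 * (L : ℝ) ^ i.m * α₀) * (1 + Fintype.card (Fin (d + 1) ⊕ Fin (d + 1))) * ((L : ℝ) ^ i.kk)⁻¹ := by positivity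
          exact (mul_le_mul_of_nonneg_right (le_max_left D 0) hsum0).trans (mul_le_mul_of_nonneg_left hbr (le_max_right _ _))
      _ ≤ max D 0 * ((1 + σ * (c35 * a₀) * JJ) * ((L : ℝ) ^ i.kk) ^ (-γ)) * Real.exp (-(δ₀ * (sfGeo d hL i).dist y y')) :=
          mul_le_mul_of_nonneg_left hexp (by positivity)
      _ = (max D 0 * (1 + σ * (c35 * a₀) * JJ)) * Real.exp (-(δ₀ * (sfGeo d hL i).dist y y')) * ((L : ℝ) ^ i.kk) ^ (-γ) := by ring
      _ ≤ B₀ * Real.exp (-(δ₀ * (sfGeo d hL i).dist y y')) * ((L : ℝ) ^ i.kk) ^ (-γ) := by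
          refine mul_le_mul_of_nonneg_right (mul_le_mul_of_nonneg_right ?_ (Real.exp_nonneg _)) hrpos
          show max D 0 * (1 + σ * (c35 * a₀) * JJ) ≤ max D 0 * (1 + σ * (c35 * a₀) * JJ) + B₁
          linarith
  · -- ENTRIES 1–3: the displayed rows
    rw [sfOps_of_ne_zero d mm ι a e hL i (E i) hn]
    refine (hE i hM₁' α₀ hα₀ hMa₁ A' hA' n hn).mono fun y y' => ?_
    rw [opGeo_len, sfGeo_len d hL i y, hrf y γ, hrf y' γ, hrf y γ₁, hrf y' γ₁, max_self, max_self]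
    have hp0 : 0 ≤ B9.pref4 (1 : ℝ) n := (pref4_pos one_pos n).le
    have hd0 : 0 ≤ (sfGeo d hL i).dist y y' := sfGeo_dist_nonneg d hL i y y'
    have hexp : Real.exp (-(δ₁ * (sfGeo d hL i).dist y y')) ≤ Real.exp (-(δ₀ * (sfGeo d hL i).dist y y')) :=
      Real.exp_le_exp.mpr (neg_le_neg (mul_le_mul_of_nonneg_right hδ₀le₁ hd0))
    have hBB : B₁ ≤ B₀ := by
      show B₁ ≤ max D 0 * (1 + σ * (c35 * a₀) * JJ) + B₁
      have : 0 ≤ max D 0 * (1 + σ * (c35 * a₀) * JJ) := by positivity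
      linarith
    exact mul_le_mul (mul_le_mul (mul_le_mul_of_nonneg_right hBB hp0) hexp (Real.exp_nonneg _) (by positivity)) hrfγ₁ (Real.rpow_nonneg hxpos.le _) (by positivity)

end Node

end Summit.QuantumFields.YangMills.BalabanUVNodes.N15.Gluing

end
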